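import Literature.NumberTheory.Automorphic.UnitaryGroupKernelClassSingularBorel
import Literature.NumberTheory.Automorphic.UnitaryGroupBorelClassLatticeSumUnfolding
import Literature.NumberTheory.Automorphic.UnitaryGroupHeisenbergBorelConj
import Literature.NumberTheory.Automorphic.UnitaryGroupHeisenbergSingularTwist
import Literature.NumberTheory.Automorphic.UnitaryGroupTruncatedKernelClassMeasurable
import Mathlib.MeasureTheory.Constructions.Polish.Basic
import HarnessLib

/-!
# The bracket `b_T` of the singular Borel class of `U(J₃)`: left `B_{γ₀}(F)`-invariance, measurability, summability
(Rogawski (1990), §7.2 Prop. 7.2.1 and (7.2.3), pp. 91–93: «`∫_{𝐙B_γ∖𝐆} [Σ_{n ∈ N_γ, n ≠ 1} f(g⁻¹n⁻¹γg) − τ(H(g) − T)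
∫_{𝐍_γ} f(g⁻¹n⁻¹γg) dn] dg`»; Arthur, Duke Math. J. 45 (1978), §8.)

Topic `NumberTheory/Automorphic`; namespace `Literature.NumberTheory.Automorphic.UnitaryGroup`. THEOREMS ONLY (no
definition, no named fact, no instance, no notation, no `sorry`). Row (L5-iii-b2) «bracket file (iii)» of the T1-qs LAW 5
road of `Cruxes/H413/Lines/F0_T1InnerFormTraceIdentity.lean` (cell `pub/hodgecm-mathlib`, crux H413), in the pattern of ★
`UnitaryGroupTruncatedTraceClassUnipotentUnfold` §2. Letters of ★ `UnitaryGroupSingularBorelBasePoint` ∕ ★ (R2)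
`UnitaryGroupKernelClassSingularBorel`: `γ₀ ∈ G(F)` (any element; the consumers take the base point `ι(d(a,b,a))`),
`B_{γ₀}(F) = arithmeticBorel ⊓ centralizer {γ₀}`, `N_{γ₀}(F) = (N(𝔸_F) ⊓ G(F)) ⊓ centralizer {γ₀}` (index type
`{n : ↥N_{γ₀}(F) // n ≠ 1}` of (R2)), the centre `n(w) = heisElt hc 0 w` (`= heisChart hc (0, w)`), `w ∈ 𝔸_E⁻`, an additive Haar measure
`μY` of `𝔸_E⁻`. THE BRACKET, spelled inline:
`b_T(y) = Σ'_{n ∈ N_{γ₀}(F), n ≠ 1} f(y⁻¹ (n γ₀) y) − 1_{T < H(y)} · μY(𝓕⁻)⁻¹ ∫_{𝔸_E⁻} f(y⁻¹ (γ₀ n(w)) y) dμY(w)`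
(sum in the order `n γ₀` of (R2); centre `n(w) = heisElt hc 0 w` in the order `γ₀ · n(w)` of ★ `UnitaryGroupHeisenbergSingularTwist`;
truncation letter `Set.indicator {y | T < borelHeight y}` of ★ `kernelBorelTailClass`; the centre integral is normalised by the
covolume `μY(𝓕⁻)` of `E⁻` in `𝔸_E⁻` (★ `traceZeroFundamentalDomain`), so that `b_T` does not depend on the choice of `μY` —
(b2-β) pen B-p04 (g28) 12:50:00Z).

* §1 `summable_singular_centralizer_ne_one` — pointwise summability for `f ∈ C_c` (★ `summable_kernel_of_hasCompactSupport`).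
* §2 `tsum_singular_centralizer_ne_one_borelCentralizer_mul` — the `n`-sum is left `B_{γ₀}(F)`-invariant (conjugation by
  `β` permutes `N_{γ₀}(F) ∖ 1`, ★ `conj_mem_unipotent_centralizer`, and fixes `γ₀`).
* §3 `borel_inv_mul_center_mul_eq_heisChart_smul` (`β⁻¹ n(w) β = n((d₀⁻¹d₂)·w)`, ★ `coordX_borel_conj` ∕ ★
  `coe_coordY_borel_conj` at `x = 0`), `diagUnit_mem_principalIdeles_of_mem_arithmeticSubgroup`,
  `integral_comp_smulTraceZero_of_mem_principalIdeles` (module `χ⁻(l) = ‖l‖^{1/2} = 1` for principal `c`-fixed `l`: ★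
  `map_smulTraceZero_eq`, ★ `traceZeroModulus_eq_sqrt`, ★ `AdeleRing.distribHaarChar_principalIdeles`),
  **`integral_center_borelCentralizer_mul`** — the centre integral is left `B_{γ₀}(F)`-invariant.
* §4 **`singularBracket_borelCentralizer_mul`** — `b_T(βy) = b_T(y)` for `β ∈ B_{γ₀}(F)` (with ★ `borelHeight_rational_borel_mul`).
  The companion leaf `UnitaryGroupSingularBracketCenter` adds the `Z_N(𝔸_F)`-invariance and the measurability of `b_T`.

## References

* J. D. Rogawski, *Automorphic Representations of Unitary Groups in Three Variables*, Ann. of Math. Stud. 123 (1990),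
  §7.2 Prop. 7.2.1, (7.2.3) (pp. 91–93) [Rogawski1990].
* J. Arthur, *A trace formula for reductive groups I*, Duke Math. J. 45 (1978), §8 [Arthur1978TraceFormulaI].
* J. Tate, *Fourier analysis in number fields and Hecke's zeta-functions* (1967), Thm. 4.3.1 [TateThesis1967].
-/

set_option autoImplicit false

noncomputable section

open MeasureTheory Measure NumberField IsDedekindDomain Topology
open scoped MatrixGroups NNReal ENNReal

namespace Literature.NumberTheory.Automorphic

namespace UnitaryGroup

variable {F E : Type} [Field F] [NumberField F] [Field E] [NumberField E] [Algebra F E]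
  {c : E ≃ₐ[F] E}

/-! ## §1 Pointwise summability of the `n`-sum -/

/-- **The `n`-sum of the bracket has finitely many non-zero terms**: for `f ∈ C_c(G(𝔸_F))` and every `y`, `n ↦ f(y⁻¹ (n γ₀) y)`
is summable on `N_{γ₀}(F) ∖ 1` (★ `summable_kernel_of_hasCompactSupport` along `n ↦ n γ₀`). [cite: Rogawski1990, §7.2 Prop. 7.2.1 (pp. 91–92)] -/
theorem summable_singular_centralizer_ne_one (γ₀ : (quasiSplit F E c 3).arithmeticSubgroup)
    {f : (quasiSplit F E c 3).Adelic → ℂ} (hf : HasCompactSupport f) (y : (quasiSplit F E c 3).Adelic) :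
    Summable fun n : {n : ↥((adelicUnipotent F E c 3).subgroupOf (quasiSplit F E c 3).arithmeticSubgroup ⊓
        Subgroup.centralizer ({γ₀} : Set (quasiSplit F E c 3).arithmeticSubgroup)) // n ≠ 1} =>
      f (y⁻¹ * (((n.1 : (quasiSplit F E c 3).arithmeticSubgroup) * γ₀ : (quasiSplit F E c 3).arithmeticSubgroup) :
        (quasiSplit F E c 3).Adelic) * y) := by
  have hi : Function.Injective fun n : {n : ↥((adelicUnipotent F E c 3).subgroupOf (quasiSplit F E c 3).arithmeticSubgroup ⊓
        Subgroup.centralizer ({γ₀} : Set (quasiSplit F E c 3).arithmeticSubgroup)) // n ≠ 1} =>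
      ((n.1 : (quasiSplit F E c 3).arithmeticSubgroup) * γ₀ : (quasiSplit F E c 3).arithmeticSubgroup) := by
    intro n n' h
    exact Subtype.ext (Subtype.ext (mul_right_cancel h))
  exact (summable_kernel_of_hasCompactSupport hf y y).comp_injective hi

/-! ## §2 The `n`-sum is left `B_{γ₀}(F)`-invariant -/

/-- **Conjugation by `β ∈ B_{γ₀}(F)` permutes `N_{γ₀}(F) ∖ 1` and fixes `γ₀`**: the `n`-sum of the bracket is left
`B_{γ₀}(F)`-invariant, `Σ'_{n ≠ 1} f((βy)⁻¹ (n γ₀) (βy)) = Σ'_{n ≠ 1} f(y⁻¹ (n γ₀) y)` (★ `conj_mem_unipotent_centralizer`;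
Mathlib `Equiv.tsum_eq`) — print's «`h` centralizes `γ` … `δ` is unique modulo `B_γ`». [cite: Rogawski1990, §7.2 Prop. 7.2.1 (p. 92)] -/
theorem tsum_singular_centralizer_ne_one_borelCentralizer_mul (γ₀ : (quasiSplit F E c 3).arithmeticSubgroup)
    (f : (quasiSplit F E c 3).Adelic → ℂ) {β : (quasiSplit F E c 3).arithmeticSubgroup}
    (hβ : β ∈ arithmeticBorel F E c 3 ⊓ Subgroup.centralizer ({γ₀} : Set (quasiSplit F E c 3).arithmeticSubgroup))
    (y : (quasiSplit F E c 3).Adelic) :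
    (∑' n : {n : ↥((adelicUnipotent F E c 3).subgroupOf (quasiSplit F E c 3).arithmeticSubgroup ⊓
        Subgroup.centralizer ({γ₀} : Set (quasiSplit F E c 3).arithmeticSubgroup)) // n ≠ 1},
      f (((β : (quasiSplit F E c 3).Adelic) * y)⁻¹ *
        (((n.1 : (quasiSplit F E c 3).arithmeticSubgroup) * γ₀ : (quasiSplit F E c 3).arithmeticSubgroup) :
          (quasiSplit F E c 3).Adelic) * ((β : (quasiSplit F E c 3).Adelic) * y))) =
      ∑' n : {n : ↥((adelicUnipotent F E c 3).subgroupOf (quasiSplit F E c 3).arithmeticSubgroup ⊓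
        Subgroup.centralizer ({γ₀} : Set (quasiSplit F E c 3).arithmeticSubgroup)) // n ≠ 1},
        f (y⁻¹ * (((n.1 : (quasiSplit F E c 3).arithmeticSubgroup) * γ₀ : (quasiSplit F E c 3).arithmeticSubgroup) :
          (quasiSplit F E c 3).Adelic) * y) := by
  -- the centre line and the conjugation action of `B_{γ₀}(F)` on it
  set Nγ : Subgroup (quasiSplit F E c 3).arithmeticSubgroup :=
    (adelicUnipotent F E c 3).subgroupOf (quasiSplit F E c 3).arithmeticSubgroup ⊓
      Subgroup.centralizer ({γ₀} : Set (quasiSplit F E c 3).arithmeticSubgroup) with hNγ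
  have hβi : β⁻¹ ∈ arithmeticBorel F E c 3 ⊓ Subgroup.centralizer ({γ₀} : Set (quasiSplit F E c 3).arithmeticSubgroup) :=
    Subgroup.inv_mem _ hβ
  -- `κ δ n = δ⁻¹ n δ`
  have hmem : ∀ {δ : (quasiSplit F E c 3).arithmeticSubgroup},
      δ ∈ arithmeticBorel F E c 3 ⊓ Subgroup.centralizer ({γ₀} : Set (quasiSplit F E c 3).arithmeticSubgroup) →
      ∀ n : ↥Nγ, δ⁻¹ * (n : (quasiSplit F E c 3).arithmeticSubgroup) * δ ∈ Nγ := by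
    intro δ hδ n
    have h := conj_mem_unipotent_centralizer (Subgroup.inv_mem _ hδ) n.2
    rwa [inv_inv] at h
  let κ : ∀ δ : (quasiSplit F E c 3).arithmeticSubgroup,
      δ ∈ arithmeticBorel F E c 3 ⊓ Subgroup.centralizer ({γ₀} : Set (quasiSplit F E c 3).arithmeticSubgroup) →
      ↥Nγ → ↥Nγ := fun δ hδ n => ⟨δ⁻¹ * (n : (quasiSplit F E c 3).arithmeticSubgroup) * δ, hmem hδ n⟩
  have hκval : ∀ δ hδ (n : ↥Nγ), ((κ δ hδ n : ↥Nγ) : (quasiSplit F E c 3).arithmeticSubgroup) =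
      δ⁻¹ * (n : (quasiSplit F E c 3).arithmeticSubgroup) * δ := fun _ _ _ => rfl
  -- conjugation by `β` as a group automorphism of `N_{γ₀}(F)`, restricted to `N_{γ₀}(F) ∖ 1`
  let e₀ : ↥Nγ ≃* ↥Nγ :=
    { toFun := κ β hβ
      invFun := κ β⁻¹ hβi
      left_inv := fun n => Subtype.ext (by rw [hκval β⁻¹ hβi, hκval β hβ, inv_inv]; group)
      right_inv := fun n => Subtype.ext (by rw [hκval β hβ, hκval β⁻¹ hβi, inv_inv]; group)
      map_mul' := fun n m => Subtype.ext (by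
        rw [Subgroup.coe_mul, hκval β hβ, hκval β hβ, hκval β hβ, Subgroup.coe_mul]; group) }
  let e : {n : ↥Nγ // n ≠ 1} ≃ {n : ↥Nγ // n ≠ 1} :=
    e₀.toEquiv.subtypeEquiv fun n => not_congr (e₀.map_eq_one_iff (x := n)).symm
  conv_rhs => rw [← e.tsum_eq]
  refine tsum_congr fun n => congrArg f ?_
  -- `(β y)⁻¹ (n γ₀) (β y) = y⁻¹ ((β⁻¹ n β) γ₀) y` since `β` centralises `γ₀`
  have hval : (((e n).1 : ↥Nγ) : (quasiSplit F E c 3).arithmeticSubgroup) =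
      β⁻¹ * ((n.1 : ↥Nγ) : (quasiSplit F E c 3).arithmeticSubgroup) * β := rfl
  have hcomm : γ₀ * β = β * γ₀ :=
    Subgroup.mem_centralizer_iff.1 (Subgroup.mem_inf.1 hβ).2 γ₀ (Set.mem_singleton γ₀)
  have hΓ : (((n.1 : ↥Nγ) : (quasiSplit F E c 3).arithmeticSubgroup) * γ₀ : (quasiSplit F E c 3).arithmeticSubgroup) =
      β * ((((e n).1 : ↥Nγ) : (quasiSplit F E c 3).arithmeticSubgroup) * γ₀) * β⁻¹ := by
    rw [hval]
    calc (((n.1 : ↥Nγ) : (quasiSplit F E c 3).arithmeticSubgroup) * γ₀ : (quasiSplit F E c 3).arithmeticSubgroup)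
        = ((n.1 : ↥Nγ) : (quasiSplit F E c 3).arithmeticSubgroup) * (γ₀ * β) * β⁻¹ := by group
      _ = ((n.1 : ↥Nγ) : (quasiSplit F E c 3).arithmeticSubgroup) * (β * γ₀) * β⁻¹ := by rw [hcomm]
      _ = β * (β⁻¹ * ((n.1 : ↥Nγ) : (quasiSplit F E c 3).arithmeticSubgroup) * β * γ₀) * β⁻¹ := by group
  rw [hΓ, Subgroup.coe_mul, Subgroup.coe_mul, Subgroup.coe_inv, _root_.mul_inv_rev]
  group

/-! ## §3 The centre integral is left `B_{γ₀}(F)`-invariant -/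

/-- **`β⁻¹ n(w) β = n((d₀⁻¹ d₂) · w)`** for `β ∈ B(𝔸_F)` with diagonal `d = diagUnit β`: the Borel subgroup acts on the centre
of `N(𝔸_F)` through the `c`-fixed idele `d₀⁻¹d₂` (★ `coordX_borel_conj`, ★ `coe_coordY_borel_conj` at `x = 0`). [cite: Rogawski1990, §1.10; §7.2 (7.2.3) p. 93] -/
theorem borel_inv_mul_center_mul_eq_heisChart_smul (hc : c * c = 1) (b : borelAdelic F E c 3)
    (w : traceZeroAdele F E c) :
    (b : (quasiSplit F E c 3).Adelic)⁻¹ *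
        ((heisChart hc ((0 : AdeleRing (𝓞 E) E), w) : adelicUnipotent F E c 3) : (quasiSplit F E c 3).Adelic) *
        (b : (quasiSplit F E c 3).Adelic) =
      ((heisChart hc ((0 : AdeleRing (𝓞 E) E),
        smulTraceZero ((diagUnit b.2 0)⁻¹ * diagUnit b.2 2)
          (conjAdele_torusCentralScalar
            (⟨torusPart b, (mem_torusInBorel_iff _).2 (torusPart_mem_torusAdelic b)⟩ : torusInBorel F E c 3)
            (adelicVal_torusPart b).symm) w) : adelicUnipotent F E c 3) : (quasiSplit F E c 3).Adelic) := by
  set u : adelicUnipotent F E c 3 := heisChart hc ((0 : AdeleRing (𝓞 E) E), w) with hu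
  set v : adelicUnipotent F E c 3 :=
    ⟨(b : (quasiSplit F E c 3).Adelic)⁻¹ * (u : (quasiSplit F E c 3).Adelic) * (b : (quasiSplit F E c 3).Adelic),
      borel_inv_mul_mul_mem_adelicUnipotent b u⟩ with hv
  have hxu : coordX u = 0 := by rw [hu, coordX_heisChart]
  have hyu : coordY hc u = w := by rw [hu, coordY_heisChart]
  have hx : coordX v = 0 := by
    rw [hv, coordX_borel_conj b u, hxu, mul_zero]
  have hy : (coordY hc v : AdeleRing (𝓞 E) E) =
      ((((diagUnit b.2 0)⁻¹ * diagUnit b.2 2 : (AdeleRing (𝓞 E) E)ˣ)) : AdeleRing (𝓞 E) E) * (w : AdeleRing (𝓞 E) E) := by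
    rw [hv, coe_coordY_borel_conj hc b u, hxu, hyu, mul_zero, map_zero, mul_zero, zero_mul, sub_zero, add_zero]
  change (v : (quasiSplit F E c 3).Adelic) = _
  congr 1
  rw [← heisChart_coord hc v]
  congr 1
  refine Prod.ext hx (Subtype.ext ?_)
  rw [hy, coe_smulTraceZero]

/-- **The diagonal entries of a rational Borel element are principal ideles** (plumbing, as in ★
`torusRootModulus_diagUnit_eq_one_of_mem_arithmeticSubgroup`). [cite: Rogawski1990, §1.10] [cite: TateThesis1967, Thm. 4.3.1] -/
theorem diagUnit_mem_principalIdeles_of_mem_arithmeticSubgroup {N : ℕ} {b : (quasiSplit F E c N).Adelic}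
    (hb : b ∈ borelAdelic F E c N) (hrat : b ∈ (quasiSplit F E c N).arithmeticSubgroup) (i : Fin N) :
    diagUnit hb i ∈ GaloisRepresentations.principalIdeles E := by
  haveI : Nontrivial (AdeleRing (𝓞 E) E) :=
    inferInstanceAs (Nontrivial (InfiniteAdeleRing E × FiniteAdeleRing (𝓞 E) E))
  obtain ⟨γ, hγ⟩ := hrat
  set a : E := (((show ↥(rational F E c N ((StdForm.antidiagonal N).over E)) from γ) : GL (Fin N) E) :
    Matrix (Fin N) (Fin N) E) i i with ha
  have hentry : (adelicVal F E c N _ ((quasiSplit F E c N).toAdelic γ) :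
      Matrix (Fin N) (Fin N) (AdeleRing (𝓞 E) E)) i i = algebraMap E (AdeleRing (𝓞 E) E) a := rfl
  have hval : (diagUnit hb i : AdeleRing (𝓞 E) E) = algebraMap E (AdeleRing (𝓞 E) E) a := by
    rw [coe_diagUnit, ← hentry, hγ]
  have ha0 : a ≠ 0 := by
    intro h0
    have hu := (diagUnit hb i).isUnit
    rw [hval, h0, map_zero] at hu
    exact not_isUnit_zero hu
  refine ⟨Units.mk0 a ha0, Units.ext ?_⟩
  rw [Units.coe_map, MonoidHom.coe_coe, hval]
  rfl

section CenterIntegral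

variable [MeasurableSpace (AdeleRing (𝓞 E) E)] [BorelSpace (AdeleRing (𝓞 E) E)]

omit [NumberField F] in
/-- **Scaling the centre by a principal `c`-fixed idele does not change the integral**: for `l ∈ 𝔸_Eˣ` principal with
`c(l) = l` and every regular additive Haar measure `μY` of `𝔸_E⁻`, `∫ G(l · w) dμY(w) = ∫ G(w) dμY(w)` — the module of
`w ↦ l w` on `𝔸_E⁻` is `χ⁻(l) = ‖l‖_{𝔸_E}^{1/2} = 1` by the product formula (★ `map_smulTraceZero_eq`, ★
`traceZeroModulus_eq_sqrt`, ★ `AdeleRing.distribHaarChar_principalIdeles`). [cite: Rogawski1990, §7.2 (7.2.3) p. 93] [cite: TateThesis1967, Thm. 4.3.1] -/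
theorem integral_comp_smulTraceZero_of_mem_principalIdeles (hc : c * c = 1) (hc1 : c ≠ 1)
    {l : (AdeleRing (𝓞 E) E)ˣ} (hl : conjAdele F E c (l : AdeleRing (𝓞 E) E) = l)
    (hp : l ∈ GaloisRepresentations.principalIdeles E)
    (μY : Measure (traceZeroAdele F E c)) [μY.IsAddHaarMeasure] [μY.Regular]
    {V : Type*} [NormedAddCommGroup V] [NormedSpace ℝ V] (G : traceZeroAdele F E c → V) :
    ∫ w, G (smulTraceZero l hl w) ∂μY = ∫ w, G w ∂μY := by
  haveI : LocallyCompactSpace (AdeleRing (𝓞 E) E) := locallyCompactSpace_adeleRing' E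
  obtain ⟨δ, hδ⟩ := exists_conjAdele_eq_neg (F := F) (E := E) hc hc1
  have hmod : traceZeroModulus l hl = 1 := by
    rw [traceZeroModulus_eq_sqrt hc δ hδ l hl, AdeleRing.distribHaarChar_principalIdeles E hp, NNReal.sqrt_one]
  have hmap : μY.map (smulTraceZero l hl) = μY := by
    rw [map_smulTraceZero_eq l hl μY, hmod, inv_one, one_smul]
  have hme : MeasurableEmbedding (smulTraceZero l hl) :=
    (smulTraceZero l hl).toHomeomorph.measurableEmbedding
  rw [← hme.integral_map, hmap]

/-- **THE CENTRE INTEGRAL OF THE BRACKET IS LEFT `B_{γ₀}(F)`-INVARIANT**: for `β ∈ B_{γ₀}(F)`,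
`∫_{𝔸_E⁻} f((βy)⁻¹ (γ₀ n(w)) (βy)) dμY(w) = ∫_{𝔸_E⁻} f(y⁻¹ (γ₀ n(w)) y) dμY(w)`: `β` centralises `γ₀` and moves the centre by
the principal `c`-fixed idele `d₀⁻¹d₂`, of module `1` on `𝔸_E⁻` — the invariance of `∫_{𝐍_γ} f(g⁻¹n⁻¹γg) dn` under
`B_γ = M N_γ` of [Prop. 7.2.1]. [cite: Rogawski1990, §7.2 Prop. 7.2.1, (7.2.3) (pp. 92–93)] [cite: TateThesis1967, Thm. 4.3.1] -/
theorem integral_center_borelCentralizer_mul (hc : c * c = 1) (hc1 : c ≠ 1)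
    (γ₀ : (quasiSplit F E c 3).arithmeticSubgroup)
    (μY : Measure (traceZeroAdele F E c)) [μY.IsAddHaarMeasure] [μY.Regular]
    {V : Type*} [NormedAddCommGroup V] [NormedSpace ℝ V] (f : (quasiSplit F E c 3).Adelic → V)
    {β : (quasiSplit F E c 3).arithmeticSubgroup}
    (hβ : β ∈ arithmeticBorel F E c 3 ⊓ Subgroup.centralizer ({γ₀} : Set (quasiSplit F E c 3).arithmeticSubgroup))
    (y : (quasiSplit F E c 3).Adelic) :
    ∫ w : traceZeroAdele F E c,
        f (((β : (quasiSplit F E c 3).Adelic) * y)⁻¹ *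
          ((γ₀ : (quasiSplit F E c 3).Adelic) *
            (((heisElt hc 0 w : unipotentInBorel F E c 3) : borelAdelic F E c 3) : (quasiSplit F E c 3).Adelic)) *
          ((β : (quasiSplit F E c 3).Adelic) * y)) ∂μY =
      ∫ w : traceZeroAdele F E c,
        f (y⁻¹ * ((γ₀ : (quasiSplit F E c 3).Adelic) *
            (((heisElt hc 0 w : unipotentInBorel F E c 3) : borelAdelic F E c 3) : (quasiSplit F E c 3).Adelic)) * y) ∂μY := by
  -- the centre in the `heisChart` spelling of ★ `UnitaryGroupHeisenbergFundamentalDomain` (definitionally the same points)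
  have key : ∀ w : traceZeroAdele F E c, (((heisElt hc 0 w : unipotentInBorel F E c 3) : borelAdelic F E c 3) : (quasiSplit F E c 3).Adelic) =
      ((heisChart hc ((0 : AdeleRing (𝓞 E) E), w) : adelicUnipotent F E c 3) : (quasiSplit F E c 3).Adelic) := fun w => rfl
  simp_rw [key]
  obtain ⟨hβB', hβC⟩ := Subgroup.mem_inf.1 hβ
  have hβB : (β : (quasiSplit F E c 3).Adelic) ∈ borelAdelic F E c 3 := (mem_arithmeticBorel_iff β).1 hβB'
  set b : borelAdelic F E c 3 := ⟨(β : (quasiSplit F E c 3).Adelic), hβB⟩ with hb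
  -- the scaling idele `l = d₀⁻¹ d₂` of `β`: `c`-fixed and principal
  set l : (AdeleRing (𝓞 E) E)ˣ := (diagUnit b.2 0)⁻¹ * diagUnit b.2 2 with hl
  have hlc : conjAdele F E c (l : AdeleRing (𝓞 E) E) = l :=
    conjAdele_torusCentralScalar
      (⟨torusPart b, (mem_torusInBorel_iff _).2 (torusPart_mem_torusAdelic b)⟩ : torusInBorel F E c 3)
      (adelicVal_torusPart b).symm
  have hlp : l ∈ GaloisRepresentations.principalIdeles E :=
    Subgroup.mul_mem _ (Subgroup.inv_mem _ (diagUnit_mem_principalIdeles_of_mem_arithmeticSubgroup b.2 β.2 0))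
      (diagUnit_mem_principalIdeles_of_mem_arithmeticSubgroup b.2 β.2 2)
  -- `β` centralises `γ₀`
  have hcomm : (β : (quasiSplit F E c 3).Adelic)⁻¹ * (γ₀ : (quasiSplit F E c 3).Adelic) * (β : (quasiSplit F E c 3).Adelic) =
      (γ₀ : (quasiSplit F E c 3).Adelic) := by
    have h : γ₀ * β = β * γ₀ := Subgroup.mem_centralizer_iff.1 hβC γ₀ (Set.mem_singleton γ₀)
    have h' : (γ₀ : (quasiSplit F E c 3).Adelic) * (β : (quasiSplit F E c 3).Adelic) =
        (β : (quasiSplit F E c 3).Adelic) * (γ₀ : (quasiSplit F E c 3).Adelic) := by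
      rw [← Subgroup.coe_mul, ← Subgroup.coe_mul, h]
    rw [mul_assoc, h', ← mul_assoc, inv_mul_cancel, one_mul]
  -- rewrite the integrand through `w ↦ l · w`
  have hpt : ∀ w : traceZeroAdele F E c,
      ((β : (quasiSplit F E c 3).Adelic) * y)⁻¹ *
          ((γ₀ : (quasiSplit F E c 3).Adelic) *
            ((heisChart hc ((0 : AdeleRing (𝓞 E) E), w) : adelicUnipotent F E c 3) : (quasiSplit F E c 3).Adelic)) *
          ((β : (quasiSplit F E c 3).Adelic) * y) =
        y⁻¹ * ((γ₀ : (quasiSplit F E c 3).Adelic) *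
            ((heisChart hc ((0 : AdeleRing (𝓞 E) E), smulTraceZero l hlc w) : adelicUnipotent F E c 3) :
              (quasiSplit F E c 3).Adelic)) * y := by
    intro w
    have hcen := borel_inv_mul_center_mul_eq_heisChart_smul hc b w
    calc ((β : (quasiSplit F E c 3).Adelic) * y)⁻¹ *
          ((γ₀ : (quasiSplit F E c 3).Adelic) *
            ((heisChart hc ((0 : AdeleRing (𝓞 E) E), w) : adelicUnipotent F E c 3) : (quasiSplit F E c 3).Adelic)) *
          ((β : (quasiSplit F E c 3).Adelic) * y)
        = y⁻¹ * (((β : (quasiSplit F E c 3).Adelic)⁻¹ * (γ₀ : (quasiSplit F E c 3).Adelic) * (β : (quasiSplit F E c 3).Adelic)) *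
            ((b : (quasiSplit F E c 3).Adelic)⁻¹ *
              ((heisChart hc ((0 : AdeleRing (𝓞 E) E), w) : adelicUnipotent F E c 3) : (quasiSplit F E c 3).Adelic) *
              (b : (quasiSplit F E c 3).Adelic))) * y := by
          simp only [hb, _root_.mul_inv_rev]; group
      _ = _ := by rw [hcomm, hcen]
  simp_rw [hpt]
  exact integral_comp_smulTraceZero_of_mem_principalIdeles hc hc1 hlc hlp μY
    (fun w => f (y⁻¹ * ((γ₀ : (quasiSplit F E c 3).Adelic) *
      ((heisChart hc ((0 : AdeleRing (𝓞 E) E), w) : adelicUnipotent F E c 3) : (quasiSplit F E c 3).Adelic)) * y))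

end CenterIntegral

/-! ## §4 The bracket is left `B_{γ₀}(F)`-invariant -/

section Bracket

variable [MeasurableSpace (AdeleRing (𝓞 E) E)] [BorelSpace (AdeleRing (𝓞 E) E)]

/-- **THE BRACKET `b_T` IS LEFT `B_{γ₀}(F)`-INVARIANT**: for `β ∈ B_{γ₀}(F) = B(F) ∩ C(γ₀)` and every `y ∈ G(𝔸_F)`,
`b_T(β y) = b_T(y)` — the `n`-sum by `tsum_singular_centralizer_ne_one_borelCentralizer_mul`, the height by ★
`borelHeight_rational_borel_mul`, the covolume-normalised centre integral by `integral_center_borelCentralizer_mul`; this is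
what makes the integrand of [Prop. 7.2.1, (7.2.3)] a function on `𝐙 B_γ(F)∖G(𝔸)`. [cite: Rogawski1990, §7.2 Prop. 7.2.1, (7.2.3) (pp. 92–93)] -/
theorem singularBracket_borelCentralizer_mul (hc : c * c = 1) (hc1 : c ≠ 1)
    (γ₀ : (quasiSplit F E c 3).arithmeticSubgroup)
    (μY : Measure (traceZeroAdele F E c)) [μY.IsAddHaarMeasure] [μY.Regular] (T : ℝ≥0)
    (f : (quasiSplit F E c 3).Adelic → ℂ) {β : (quasiSplit F E c 3).arithmeticSubgroup}
    (hβ : β ∈ arithmeticBorel F E c 3 ⊓ Subgroup.centralizer ({γ₀} : Set (quasiSplit F E c 3).arithmeticSubgroup))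
    (y : (quasiSplit F E c 3).Adelic) :
    (∑' n : {n : ↥((adelicUnipotent F E c 3).subgroupOf (quasiSplit F E c 3).arithmeticSubgroup ⊓
        Subgroup.centralizer ({γ₀} : Set (quasiSplit F E c 3).arithmeticSubgroup)) // n ≠ 1},
      f (((β : (quasiSplit F E c 3).Adelic) * y)⁻¹ * (((n.1 : (quasiSplit F E c 3).arithmeticSubgroup) * γ₀ : (quasiSplit F E c 3).arithmeticSubgroup) :
        (quasiSplit F E c 3).Adelic) * ((β : (quasiSplit F E c 3).Adelic) * y))) -
      Set.indicator {y : (quasiSplit F E c 3).Adelic | T < borelHeight y}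
        (fun y => (μY (traceZeroFundamentalDomain F E c)).toReal⁻¹ • ∫ w : traceZeroAdele F E c,
          f (y⁻¹ * ((γ₀ : (quasiSplit F E c 3).Adelic) *
            (((heisElt hc 0 w : unipotentInBorel F E c 3) : borelAdelic F E c 3) : (quasiSplit F E c 3).Adelic)) * y) ∂μY)
        ((β : (quasiSplit F E c 3).Adelic) * y) =
    (∑' n : {n : ↥((adelicUnipotent F E c 3).subgroupOf (quasiSplit F E c 3).arithmeticSubgroup ⊓
        Subgroup.centralizer ({γ₀} : Set (quasiSplit F E c 3).arithmeticSubgroup)) // n ≠ 1},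
      f ((y)⁻¹ * (((n.1 : (quasiSplit F E c 3).arithmeticSubgroup) * γ₀ : (quasiSplit F E c 3).arithmeticSubgroup) :
        (quasiSplit F E c 3).Adelic) * (y))) -
      Set.indicator {y : (quasiSplit F E c 3).Adelic | T < borelHeight y}
        (fun y => (μY (traceZeroFundamentalDomain F E c)).toReal⁻¹ • ∫ w : traceZeroAdele F E c,
          f (y⁻¹ * ((γ₀ : (quasiSplit F E c 3).Adelic) *
            (((heisElt hc 0 w : unipotentInBorel F E c 3) : borelAdelic F E c 3) : (quasiSplit F E c 3).Adelic)) * y) ∂μY) y := by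
  obtain ⟨hβB', -⟩ := Subgroup.mem_inf.1 hβ
  rw [tsum_singular_centralizer_ne_one_borelCentralizer_mul γ₀ f hβ y]
  congr 1
  -- the height is `B(F)`-invariant
  obtain ⟨γ, hγ⟩ := β.2
  have hγB : (quasiSplit F E c 3).toAdelic γ ∈ borelAdelic F E c 3 := by
    rw [hγ]; exact (mem_arithmeticBorel_iff β).1 hβB'
  have hH : borelHeight ((β : (quasiSplit F E c 3).Adelic) * y) = borelHeight y := by
    rw [← hγ]; exact borelHeight_rational_borel_mul γ hγB y
  by_cases hy : T < borelHeight y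
  · have hy' : (β : (quasiSplit F E c 3).Adelic) * y ∈ {y : (quasiSplit F E c 3).Adelic | T < borelHeight y} := by
      change T < borelHeight ((β : (quasiSplit F E c 3).Adelic) * y); rwa [hH]
    rw [Set.indicator_of_mem hy', Set.indicator_of_mem (show y ∈ {y : (quasiSplit F E c 3).Adelic | T < borelHeight y} from hy),
      integral_center_borelCentralizer_mul hc hc1 γ₀ μY f hβ y]
  · have hy' : (β : (quasiSplit F E c 3).Adelic) * y ∉ {y : (quasiSplit F E c 3).Adelic | T < borelHeight y} := by
      change ¬ T < borelHeight ((β : (quasiSplit F E c 3).Adelic) * y); rwa [hH]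
    rw [Set.indicator_of_notMem hy', Set.indicator_of_notMem (show y ∉ {y : (quasiSplit F E c 3).Adelic | T < borelHeight y} from hy)]

end Bracket

end UnitaryGroup

end Literature.NumberTheory.Automorphic

end
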